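import Mathlib
import HarnessLib
import Summits.HubbardSuperconductivity.HubbardSuperconductivity.Theorems.KLProgrammeKLRegimeEnginePairLadderSigned
import Summits.HubbardSuperconductivity.HubbardSuperconductivity.Theorems.KLProgrammeKLRegimeEnginePairLadderInsertion
import Summits.HubbardSuperconductivity.HubbardSuperconductivity.Theorems.KLProgrammeKLRegimeSplitEngineV9

/-!
# Route `KLProgramme` — crux K3, ENGINE child (gen-5 engine slot, (E2) row re-typed after E2-DRIVE): (E2-v9) `PairLadderStepAtV9` at `1 ≤ n`
# BY NAME from expansion-level data — `pairLadderStepAtV9_of_expansion`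

Cell gate-hubbard-kl, seat hubbard-kl-k3c1-p1 (g4).  The (E2-v9) text (`…KLRegimeSplitEngineV9`, p1 g8; plan g12 (R12′)/(R13)) = (E2-v8) verbatim
with the `1 ≤ n` budget enlarged by the crossed particle–hole gains (X) `(P.Klam·U)²·(G.phGain n |k−k′|_𝕋 + G.phGain n |k+k′−Qm|_𝕋)` — the repair
of this seat's E2-DRIVE finding (evidence #17–#19 on stmt-HubbardSuperconductivity-19855: the crossed particle–hole increment at forward-exchange
external configurations is `≍ N₀U²` per scale, ungained; (ANG) was dropped as consumer-less, k3c1-p1 02:25Z / p1 02:27Z).  This file is the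
by-name constructor: `pairLadderStepAtV8_of_expansion`'s inputs with the budget line enlarged by (X) (`klpls_signedStepReal_of_expansion`,
p469901, at `B := V8 budget + (X)`).  Bookkeeping only; nothing about the model is asserted.  0 kit.
-/

noncomputable section

namespace Summit.HubbardSuperconductivity.HubbardSuperconductivity.Theorems.KLRegimeSplit

set_option linter.dupNamespace false -- summit = problem name (single-conjunct summit), D-0017

open Finset Matrix Literature.MathematicalPhysics.QuantumLattice Literature.Probability.LatticeModels
open Summit.HubbardSuperconductivity.HubbardSuperconductivity.Theorems.KLProgrammeCooperResummation
open Summit.HubbardSuperconductivity.HubbardSuperconductivity.Theorems.KLProgrammeLegKernels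

section Model

variable (L M : ℕ) [NeZero L] [NeZero M]
variable {F : Type*} [Fintype F] [DecidableEq F] [Nonempty F]

/-- **(E2-v9) at `1 ≤ n` from expansion-level data** — the E2-DRIVE repair text (p1 g8 `…SplitEngineV9`, plan g12 (R12′)/(R13)): as
`pairLadderStepAtV8_of_expansion`, with the budget enlarged by the crossed-channel gains (X) `(P.Klam·U)²·(phGain n |k−k′|_𝕋 + phGain n |k+k′−Qm|_𝕋)`
(`klpls_signedStepReal_of_expansion`, p469901, with `B := V8 budget + (X)`). -/
theorem pairLadderStepAtV9_of_expansion {G : GeoConsts} {P : SplitConsts} {Q : EngConsts} {β U μ : ℝ} {K₀ : TrigPolyC4v} {n : ℕ}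
    (a₀ : F) (hn : 1 ≤ n)
    (hsplit : PairArrayAtV2 L M P Q β U μ K₀ (n - 1)) (hD : 0 ≤ P.C_W + klLegKappa * Q.CR * P.Klam ^ 3)
    (hsmall : G.bhi * (2 * |U| + (P.C_W + klLegKappa * Q.CR * P.Klam ^ 3) * U ^ 2) ≤ 1 / 3)
    (hexp : ∀ Qm : TorusSite 2 L, IsPairClassAt L Qm n →
      ∃ (K : Matrix (TorusSite 2 L × F) (TorusSite 2 L × F) ℂ) (z' : TorusSite 2 L × F → ℂ)
        (TK : Matrix (TorusSite 2 L × F) (TorusSite 2 L × F) ℂ) (m' : ℝ),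
        0 ≤ m' ∧ (∀ x y, ‖K x y‖ ≤ m') ∧ m' * ∑ x, ‖z' x‖ ≤ 1 / 3 ∧ ∑ x, ‖z' x‖ ≤ G.bhi ∧
        (∑ p, ‖∑ b, z' (p, b)‖) - (∑ p, ∑ b, z' (p, b)).re ≤ 2 * klEdge G n (klTorusNorm L Qm) ∧ (∀ p, (∑ b, z' (p, b)).im = 0) ∧
        HasSum (fun j : ℕ => K * (-(Matrix.diagonal z' * K)) ^ j) TK ∧
        ∀ k ∈ klBall L μ K₀, ∀ k' ∈ klBall L μ K₀,
          ‖klPairAmplitude L M β U μ K₀ n Qm k k' - TK (k, a₀) (k', a₀)‖ +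
            (‖K (k, a₀) (k', a₀) - klPairArray L M β U μ K₀ (n - 1) Qm k k'‖ +
              3 / 2 * (2 * |U| + (P.C_W + klLegKappa * Q.CR * P.Klam ^ 3) * U ^ 2) *
                ∑ b, ‖K (k, a₀) b - klPairArray L M β U μ K₀ (n - 1) Qm k b.1‖ * ‖z' b‖ +
              3 / 2 * m' * ∑ a, ‖z' a‖ * ‖K a (k', a₀) - klPairArray L M β U μ K₀ (n - 1) Qm a.1 k'‖ +
              9 / 4 * m' * (2 * |U| + (P.C_W + klLegKappa * Q.CR * P.Klam ^ 3) * U ^ 2) *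
                ∑ a, ∑ b, ‖z' a‖ * ‖K a b - klPairArray L M β U μ K₀ (n - 1) Qm a.1 b.1‖ * ‖z' b‖) ≤
          drivePBar G P U (n - 1) + eremBar G P Q U β L (n - 1) + thermalBar G P U β n +
            legDressBarQ G P Q U n (legSliceCountT L β μ K₀ n ![k', Qm - k', Qm - k, k]) +
            (P.Klam * U) ^ 2 * (G.phGain n (klTorusNorm L (k - k')) + G.phGain n (klTorusNorm L (k + k' - Qm)))) :
    PairLadderStepAtV9 L M G P Q β U μ K₀ n := by
  have hm : 0 ≤ 2 * |U| + (P.C_W + klLegKappa * Q.CR * P.Klam ^ 3) * U ^ 2 := by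
    have : 0 ≤ (P.C_W + klLegKappa * Q.CR * P.Klam ^ 3) * U ^ 2 := mul_nonneg hD (sq_nonneg U)
    have : 0 ≤ |U| := abs_nonneg U
    linarith
  refine ⟨fun h0 => absurd h0 (by omega), fun _ Qm hQm => ?_⟩
  obtain ⟨w, hb, hE, -, N, hN1, -, hbd⟩ := klpls_signedStepReal_of_expansion L M a₀
    (fun Qm => 2 * klEdge G n (klTorusNorm L Qm))
    (fun Qm k k' => drivePBar G P U (n - 1) + eremBar G P Q U β L (n - 1) + thermalBar G P U β n +
      legDressBarQ G P Q U n (legSliceCountT L β μ K₀ n ![k', Qm - k', Qm - k, k]) +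
      (P.Klam * U) ^ 2 * (G.phGain n (klTorusNorm L (k - k')) + G.phGain n (klTorusNorm L (k + k' - Qm))))
    hm (fun Qm s t => klpli_pairArray_entry_le L M hsplit hD Qm s t) hsmall hexp Qm hQm
  exact ⟨w, hb, hE, N, hN1, hbd⟩

end Model

end Summit.HubbardSuperconductivity.HubbardSuperconductivity.Theorems.KLRegimeSplit

end
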